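import Summits.NavierStokesRegularity.NavierStokesRegularity.Theses.AxisymmetricExtremality
import Literature.Analysis.FluidPDE.KatoMaximalTime
import Literature.Analysis.FluidPDE.AxisymmetricVorticityTransport
import Literature.Analysis.FluidPDE.HomSobolevRepresentedL3

/-!
# Crux `AxisymmetricExtremality.AxisymmetricKatoGlobal` (stmt-NavierStokesRegularity-15453), line
`registered` — negative lemma: in `stub_swirlAxisModulus` the smoothness hypothesis is load-bearing

Refuter file (cdisprove seat, `Theorems/AxisymmetricKatoGlobal/Negative/`).  The open stub of the
picked line (`Cruxes/AxisymmetricKatoGlobal/Lines/registered.lean`, stub 3) reads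

  `stub_swirlAxisModulus : ∀ ν > 0, ∀ T > 0, ∀ u₀ g u, g.Represents (complexify ∘ u₀) →
     IsKatoSolutionOn T ν u₀ u → ContDiffOn ℝ ⊤ (uncurry u) (Ioo 0 T ×ˢ univ) →
     (∀ t ∈ Ioo 0 T, IsAxisymmetric (u t)) → ∀ t₀ ∈ Ioo 0 T, ∃ C δ₀, 0 < δ₀ ∧ δ₀ < 1 ∧
     ∀ t ∈ Ico t₀ T, ∀ x, cylRadius x ≤ δ₀ → |swirl (u t) x| ≤ C / |log (cylRadius x)|³`.

**Finding.** With the hypothesis `ContDiffOn ℝ ⊤ (uncurry u) (Ioo 0 T ×ˢ univ)` deleted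
(`SwirlAxisModulusWithoutSmooth`, everything else verbatim) the statement is FALSE
(`stub_swirlAxisModulus_false_without_smooth`).  Reason: `IsKatoSolutionOn` determines the
slices `u t`, `t > 0`, only up to spatial null sets (the duality identity, `ContinuousInLpOn`
and measurability are integral / a.e. conditions; only `u 0 = u₀` is pointwise), and pointwise
axisymmetry survives modifications on rotation-invariant null sets, whereas the conclusion is a
POINTWISE modulus.  Witness: `ν = T = 1`, `u₀ = 0`, `g = 0`, and the family `spikeFamily` which is
`0` except at `t = 1/2`, where it is the axisymmetric field `spikeSlice x = c(‖x‖) • (−x₁, x₀, 0)`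
supported on the null set `⋃ₙ sphere 0 2⁻ⁿ` with `c(2⁻ⁿ) = 2^{3n}`: its swirl at the equator point
`2⁻ⁿ e₀` is `2ⁿ`, while `C / |log 2⁻ⁿ|³ ≤ 8 max C 0`.

What this tells the lead: the smoothness hypothesis of stub 3 is used ESSENTIALLY (if only to
pass from the a.e. information carried by `IsKatoSolutionOn` to the pointwise modulus); an a.e.
or `essSup` form of the modulus would be the smoothness-free statement.  No claim is made about
the stub as registered (which keeps `ContDiffOn` and is, given the landed stubs, equivalent to
the crux).
-/

set_option linter.dupNamespace false

noncomputable section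

open MeasureTheory Set Function Filter Topology Metric
open Literature.Analysis.FluidPDE Literature.Analysis.FunctionSpaces
open Literature.Analysis.FunctionSpaces.EuclideanSpace (complexify)
open scoped ENNReal NNReal RealInnerProductSpace

namespace Summit.NavierStokesRegularity.NavierStokesRegularity.Theorems.AxisymmetricKatoGlobal.Negative

local notation "ℝ³" => EuclideanSpace ℝ (Fin 3)
local notation "ℂ³" => EuclideanSpace ℂ (Fin 3)

/-! ### The mutant: stub 3 without the smoothness hypothesis -/

/-- `stub_swirlAxisModulus` of line `registered` with the hypothesis
`ContDiffOn ℝ ⊤ (uncurry u) (Ioo 0 T ×ˢ univ)` deleted (everything else verbatim). -/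
def SwirlAxisModulusWithoutSmooth : Prop :=
  ∀ ν : ℝ, 0 < ν → ∀ T : ℝ, 0 < T → ∀ (u₀ : ℝ³ → ℝ³)
    (g : HomSobolev ℝ³ (EuclideanSpace ℂ (Fin 3)) (1 / 2 : ℝ)) (u : ℝ → ℝ³ → ℝ³),
    g.Represents (Literature.Analysis.FunctionSpaces.EuclideanSpace.complexify ∘ u₀) →
    IsKatoSolutionOn T ν u₀ u →
    (∀ t ∈ Ioo 0 T, IsAxisymmetric (u t)) →
    ∀ t₀ ∈ Ioo 0 T, ∃ C δ₀ : ℝ, 0 < δ₀ ∧ δ₀ < 1 ∧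
      ∀ t ∈ Ico t₀ T, ∀ x : ℝ³, cylRadius x ≤ δ₀ →
        |swirl (u t) x| ≤ C / |Real.log (cylRadius x)| ^ 3

/-! ### The witness -/

/-- Dyadic radii `ρₙ = 2⁻ⁿ`. [folklore] -/
def dyadRadius (n : ℕ) : ℝ := (1 / 2 : ℝ) ^ n

/-- `ρₙ > 0`. [folklore] -/
theorem dyadRadius_pos (n : ℕ) : 0 < dyadRadius n := pow_pos (by norm_num) n

open Classical in
/-- The spike coefficient `c(s) = s⁻³` on the dyadic radii, `0` elsewhere. [folklore] -/
def spikeCoeff (s : ℝ) : ℝ := if s ∈ Set.range dyadRadius then (s ^ 3)⁻¹ else 0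

/-- The rotational field `r e_θ = (−x₁, x₀, 0)`. [folklore] -/
def rotField (x : ℝ³) : ℝ³ := WithLp.toLp 2 ![-x 1, x 0, 0]

/-- The spike slice `c(‖x‖) • (−x₁, x₀, 0)`: axisymmetric, supported on `⋃ₙ sphere 0 ρₙ`. [folklore] -/
def spikeSlice (x : ℝ³) : ℝ³ := spikeCoeff ‖x‖ • rotField x

/-- The witness family: `0` at every time except `t = 1/2`, where it is the spike slice. [folklore] -/
def spikeFamily (t : ℝ) (x : ℝ³) : ℝ³ := if t = 1 / 2 then spikeSlice x else 0

/-- The rotational field is rotation-equivariant. [folklore] -/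
theorem rotField_rotZ (θ : ℝ) (x : ℝ³) : rotField (rotZ θ x) = rotZ θ (rotField x) := by
  ext i
  fin_cases i <;> simp [rotField, rotZ] <;> ring

/-- The spike slice is axisymmetric. [folklore] -/
theorem spikeSlice_isAxisymmetric : IsAxisymmetric spikeSlice := fun θ x => by
  simp only [spikeSlice, norm_rotZ, rotField_rotZ]
  exact ((rotZL θ).map_smul (spikeCoeff ‖x‖) (rotField x)).symm

/-- The zero field is axisymmetric. [folklore] -/
theorem isAxisymmetric_zero : IsAxisymmetric (0 : ℝ³ → ℝ³) := fun θ x => by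
  simp only [Pi.zero_apply]
  exact ((rotZL θ).map_zero).symm

/-- Every slice of the witness family is axisymmetric. [folklore] -/
theorem spikeFamily_isAxisymmetric (t : ℝ) : IsAxisymmetric (spikeFamily t) := by
  by_cases ht : t = 1 / 2
  · have : spikeFamily t = spikeSlice := funext fun x => if_pos ht
    rw [this]
    exact spikeSlice_isAxisymmetric
  · have : spikeFamily t = 0 := funext fun x => if_neg ht
    rw [this]
    exact isAxisymmetric_zero

/-- The spike slice vanishes off the null set `⋃ₙ sphere 0 ρₙ`, hence a.e. [folklore] -/
theorem spikeSlice_ae_zero : spikeSlice =ᵐ[volume] (0 : ℝ³ → ℝ³) := by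
  have hnull : volume (⋃ n : ℕ, sphere (0 : ℝ³) (dyadRadius n)) = 0 :=
    measure_iUnion_null fun n => Measure.addHaar_sphere volume (0 : ℝ³) (dyadRadius n)
  have hsub : {x : ℝ³ | spikeSlice x ≠ 0} ⊆ ⋃ n : ℕ, sphere (0 : ℝ³) (dyadRadius n) := by
    intro x hx
    have hc : spikeCoeff ‖x‖ ≠ 0 := by
      intro h0
      exact hx (by simp [spikeSlice, h0])
    unfold spikeCoeff at hc
    split_ifs at hc with hmem
    · obtain ⟨n, hn⟩ := hmem
      exact mem_iUnion.2 ⟨n, mem_sphere_zero_iff_norm.2 hn.symm⟩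
    · exact absurd rfl hc
  exact measure_mono_null hsub hnull

/-- Every slice of the witness family vanishes a.e. [folklore] -/
theorem spikeFamily_ae_zero (t : ℝ) : spikeFamily t =ᵐ[volume] (0 : ℝ³ → ℝ³) := by
  by_cases ht : t = 1 / 2
  · have : spikeFamily t = spikeSlice := funext fun x => if_pos ht
    rw [this]
    exact spikeSlice_ae_zero
  · have : spikeFamily t = 0 := funext fun x => if_neg ht
    rw [this]

/-- Pairings of a slice of the witness family with anything vanish. [folklore] -/
theorem integral_inner_spikeFamily (t : ℝ) (w : ℝ³ → ℝ³) :
    ∫ x, ⟪spikeFamily t x, w x⟫ = 0 := by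
  refine integral_eq_zero_of_ae ?_
  filter_upwards [spikeFamily_ae_zero t] with x hx
  simp [hx]

/-- Every slice of the witness family is weakly divergence free (it is a.e. zero). [folklore] -/
theorem spikeFamily_isWeaklyDivFree (t : ℝ) : IsWeaklyDivFree (spikeFamily t) :=
  fun θ _ => integral_inner_spikeFamily t (gradient θ)

/-- The witness family is a mild solution on `[0, 1)` with datum `0` (all pairings vanish). [folklore] -/
theorem spikeFamily_isMildNSSolutionOn :
    IsMildNSSolutionOn (Ico 0 1) 1 0 (0 : ℝ³ → ℝ³) spikeFamily := by
  refine ⟨fun t _ => spikeFamily_isWeaklyDivFree t, fun t _ φ _ _ => ?_⟩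
  have h2 : (fun τ => ∫ x, ⟪spikeFamily τ x, convect (spikeFamily τ) (heatTest 1 φ (t - τ)) x⟫) =
      fun _ => 0 := funext fun τ => integral_inner_spikeFamily τ _
  rw [integral_inner_spikeFamily, h2]
  simp

/-- The witness family is in `C([0,1); L³)` (every slice is a.e. zero). [folklore] -/
theorem spikeFamily_continuousInLpOn : ContinuousInLpOn (Ico 0 1) 3 spikeFamily := by
  refine ⟨fun t _ => MemLp.zero.ae_eq (spikeFamily_ae_zero t).symm, fun t₀ _ => ?_⟩
  have h : (fun t => eLpNorm (spikeFamily t - spikeFamily t₀) 3 volume) = fun _ => 0 := by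
    funext t
    have hae : spikeFamily t - spikeFamily t₀ =ᵐ[volume] (0 : ℝ³ → ℝ³) := by
      filter_upwards [spikeFamily_ae_zero t, spikeFamily_ae_zero t₀] with x hx hx₀
      simp [hx, hx₀]
    rw [eLpNorm_congr_ae hae, eLpNorm_zero]
  rw [h]
  exact tendsto_const_nhds

/-- The witness family vanishes a.e. on space–time (it is supported in `{t = 1/2}`). [folklore] -/
theorem uncurry_spikeFamily_ae_zero :
    (fun z : ℝ × ℝ³ => uncurry spikeFamily z) =ᵐ[volume] fun _ => (0 : ℝ³) := by
  have hsub : {z : ℝ × ℝ³ | uncurry spikeFamily z ≠ 0} ⊆ ({(1 / 2 : ℝ)} : Set ℝ) ×ˢ (univ : Set ℝ³) := by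
    intro z hz
    refine ⟨mem_singleton_iff.2 ?_, trivial⟩
    by_contra h1
    exact hz (show spikeFamily z.1 z.2 = 0 from if_neg h1)
  have hnull : volume (({(1 / 2 : ℝ)} : Set ℝ) ×ˢ (univ : Set ℝ³)) = 0 := by
    rw [Measure.volume_eq_prod, Measure.prod_prod, Real.volume_singleton, zero_mul]
  exact measure_mono_null hsub hnull

/-- **The witness is a Kato solution on `[0, 1)` (viscosity `1`, datum `0`)** in the tree's formal
sense: all integral / a.e. clauses hold because every slice is a.e. zero, and `u 0 = 0`
literally. [folklore] -/
theorem spikeFamily_isKatoSolutionOn : IsKatoSolutionOn 1 1 (0 : ℝ³ → ℝ³) spikeFamily := by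
  refine ⟨spikeFamily_isMildNSSolutionOn, spikeFamily_continuousInLpOn, ?_, ?_⟩
  · funext x
    simp [spikeFamily]
  · have hae : (fun z : ℝ × ℝ³ => uncurry spikeFamily z) =ᵐ[volume.restrict (Ioo (0 : ℝ) 1 ×ˢ (univ : Set ℝ³))]
        fun _ => (0 : ℝ³) :=
      ae_restrict_of_ae uncurry_spikeFamily_ae_zero
    exact aestronglyMeasurable_const.congr hae.symm

/-- The zero class represents the (complexified) zero datum. [folklore] -/
theorem represents_zero_datum :
    (0 : HomSobolev ℝ³ (EuclideanSpace ℂ (Fin 3)) (1 / 2 : ℝ)).Represents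
      (Literature.Analysis.FunctionSpaces.EuclideanSpace.complexify ∘ (0 : ℝ³ → ℝ³)) := by
  have h0 : Literature.Analysis.FunctionSpaces.EuclideanSpace.complexify ∘ (0 : ℝ³ → ℝ³) = 0 := by
    funext x
    simp
  rw [h0]
  exact HomSobolev.represents_zero

/-! ### The equator points and the swirl there -/

/-- The equator point `s e₀`. [folklore] -/
def xPt (s : ℝ) : ℝ³ := EuclideanSpace.single (0 : Fin 3) s

/-- `‖s e₀‖ = s` for `s ≥ 0`. [folklore] -/
theorem norm_xPt {s : ℝ} (hs : 0 ≤ s) : ‖xPt s‖ = s := by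
  rw [xPt, EuclideanSpace.norm_eq]
  simp [Real.sqrt_sq hs]

/-- `cylRadius (s e₀) = s` for `s ≥ 0`. [folklore] -/
theorem cylRadius_xPt {s : ℝ} (hs : 0 ≤ s) : cylRadius (xPt s) = s := by
  simp [cylRadius, xPt, Real.sqrt_sq hs]

/-- The swirl of the spike slice at the dyadic equator point `ρₙ e₀` is `ρₙ⁻¹`. [folklore] -/
theorem swirl_spikeSlice_xPt (n : ℕ) : swirl spikeSlice (xPt (dyadRadius n)) = (dyadRadius n)⁻¹ := by
  have hρ := dyadRadius_pos n
  have hc : spikeCoeff (dyadRadius n) = ((dyadRadius n) ^ 3)⁻¹ := by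
    simp [spikeCoeff]
  simp only [swirl, spikeSlice]
  rw [norm_xPt hρ.le, hc]
  have h3 : dyadRadius n ^ 3 ≠ 0 := pow_ne_zero 3 hρ.ne'
  simp [rotField, xPt]
  field_simp

/-- `|log ρₙ| = n log 2`. [folklore] -/
theorem abs_log_dyadRadius (n : ℕ) : |Real.log (dyadRadius n)| = n * Real.log 2 := by
  rw [dyadRadius, Real.log_pow, one_div, Real.log_inv, mul_neg, abs_neg, abs_of_nonneg]
  exact mul_nonneg n.cast_nonneg (Real.log_nonneg one_le_two)

/-! ### The negative lemma -/

/-- **In `stub_swirlAxisModulus` the smoothness hypothesis is load-bearing.**  Without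
`ContDiffOn ℝ ⊤ (uncurry u) (Ioo 0 T ×ˢ univ)` the statement fails for the a.e.-zero Kato
solution `spikeFamily` (datum `0`, viscosity `1`, `T = 1`, `t₀ = 1/2`): at `t = 1/2` its swirl at
`ρ_N e₀` is `2^N`, while `C / |log ρ_N|³ = C / (N log 2)³ ≤ 8 max C 0 < 2^N` for `N` large with
`ρ_N ≤ δ₀`. [folklore] -/
theorem stub_swirlAxisModulus_false_without_smooth : ¬ SwirlAxisModulusWithoutSmooth := by
  intro h
  obtain ⟨C, δ₀, hδ₀, -, hmod⟩ := h 1 one_pos 1 one_pos 0 0 spikeFamily represents_zero_datum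
    spikeFamily_isKatoSolutionOn (fun t _ => spikeFamily_isAxisymmetric t) (1 / 2)
    ⟨by norm_num, by norm_num⟩
  -- choose `N ≥ 1` with `ρ_N ≤ δ₀` and `8 max C 0 < 2 ^ N`
  obtain ⟨n, hn⟩ := pow_unbounded_of_one_lt (8 * max C 0) (by norm_num : (1 : ℝ) < 2)
  obtain ⟨m, hm⟩ := exists_pow_lt_of_lt_one hδ₀ (by norm_num : (1 / 2 : ℝ) < 1)
  set N : ℕ := max n m + 1 with hN
  have hNn : n ≤ N := (le_max_left n m).trans (Nat.le_succ _)
  have hNm : m ≤ N := (le_max_right n m).trans (Nat.le_succ _)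
  have hN1 : (1 : ℝ) ≤ N := by exact_mod_cast Nat.succ_le_succ (Nat.zero_le _)
  have hrad_le : dyadRadius N ≤ δ₀ :=
    (pow_le_pow_of_le_one (by norm_num) (by norm_num) hNm).trans hm.le
  have hpow : 8 * max C 0 < (2 : ℝ) ^ N := hn.trans_le (pow_le_pow_right₀ (by norm_num) hNn)
  have key := hmod (1 / 2) ⟨le_rfl, by norm_num⟩ (xPt (dyadRadius N))
    (by rw [cylRadius_xPt (dyadRadius_pos N).le]; exact hrad_le)
  have hslice : spikeFamily (1 / 2) = spikeSlice := funext fun x => if_pos rfl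
  rw [hslice, swirl_spikeSlice_xPt, cylRadius_xPt (dyadRadius_pos N).le, abs_log_dyadRadius,
    abs_of_pos (inv_pos.2 (dyadRadius_pos N))] at key
  -- `key : (ρ_N)⁻¹ ≤ C / (N log 2) ^ 3`; but `(ρ_N)⁻¹ = 2 ^ N`
  have hinv : (dyadRadius N)⁻¹ = (2 : ℝ) ^ N := by
    rw [dyadRadius, ← inv_pow]
    norm_num
  rw [hinv] at key
  -- the right-hand side is at most `8 max C 0`
  have hlog : (1 / 2 : ℝ) ≤ Real.log 2 := by
    have := Real.log_two_gt_d9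
    linarith
  have hL : (1 / 8 : ℝ) ≤ ((N : ℝ) * Real.log 2) ^ 3 := by
    have h1 : (1 / 2 : ℝ) ≤ (N : ℝ) * Real.log 2 := by nlinarith
    calc (1 / 8 : ℝ) = (1 / 2) ^ 3 := by norm_num
      _ ≤ ((N : ℝ) * Real.log 2) ^ 3 := pow_le_pow_left₀ (by norm_num) h1 3
  have hLpos : (0 : ℝ) < ((N : ℝ) * Real.log 2) ^ 3 := by linarith
  have hbound : C / ((N : ℝ) * Real.log 2) ^ 3 ≤ 8 * max C 0 :=
    calc C / ((N : ℝ) * Real.log 2) ^ 3 ≤ max C 0 / ((N : ℝ) * Real.log 2) ^ 3 :=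
          div_le_div_of_nonneg_right (le_max_left C 0) hLpos.le
      _ ≤ max C 0 / (1 / 8) := div_le_div_of_nonneg_left (le_max_right C 0) (by norm_num) hL
      _ = 8 * max C 0 := by ring
  linarith

end Summit.NavierStokesRegularity.NavierStokesRegularity.Theorems.AxisymmetricKatoGlobal.Negative

end
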